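import Summits.QuantumFields.YangMills.Theorems.BalabanUVNodesN14DressedWeightSlice
import Literature.MathematicalPhysics.QuantumFieldTheory.Balaban1983to89.B16DressedActionTerm

/-!
# BalabanUVNodes ∕ node N14 = NE1′ — THE BORN DRESSED TERM ALONG A WEIGHT SLICE IS A BIRTH SLICE: END-F's (w1) binder
# `T4BirthChartTransport.BirthSlice` for DRESSED births follows from END-F's own (w2-act) weight-slice datum + the observable's
# slice regularity, with the (1.75)ₜ birth size `B·e^{3(s+l₀B)}·l₀` — one wall item of the NE1′ record is NOT independent for the
# dressed part (count-neutral)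

Cell `pub-ymgap`, HUMAN RULING D-0062 (Track A at full width), seat `pub-ymgap-dag-n14-c` (R134 ACCELERATION, strategy s1), generation 2; route
`Summits/QuantumFields/YangMills/Theses/BalabanUVNodes.lean` (cluster K3, `--supports`); venue ruling R424 (`YangMills/Theorems`, namespace
`YMDAG.N14.DressedBirth`).  ADDITIVE — imports n14-a's `Thm/BalabanUVNodesN14DressedWeightSlice` (p409924: `weight_mul_exp`, the observable's
slice-regularity hypothesis shape `hG`, its Wilson-word inhabitant `wilsonWord_alongSlices`; through it `T4TrajectoryDensity` — `WeightSlice`,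
`weight`, (1.74) `mul_exp_le_re_integral_weight` — and `T4BirthChartTransport.BirthSlice`) and this seat's `B16DressedActionTerm` (p453150:
`dressLog`, `norm_dressLog_le`) ONLY; THEOREMS ONLY; modifies nothing; every cited lemma is used BY NAME.

WHY.  The NE1′ owner's END-F (`DressedRoot.transportLeaf_of_centredExponent`, the transport leaf `htr` of `BookingLeaves`) keeps DISPLAYED, among
the wall of record, (w1) `hsl : BirthSlice (Fn b k′ k′) latMove latN (𝒦 b k′ k′) w r (T.gen b k′)` — the births are analytic on the lattice
chart with the booked birth size — and (w2-act) `hB`∕`hE : RealBaseAt ∕ ExponentSliceAt` — the step's weight is a WEIGHT SLICE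
(`T4TrajectoryDensity.weightSlice_of_exponentSliceAt`), the printed TYPE of [Balaban1989LargeFieldII] (1.65) p. 375 ∕ (1.71)–(1.75) pp. 379–380.
For the DRESSED births — the born dressed action terms `D_τ(U) = Log ∫ω_U e^{τG_U} − Log ∫ω_U` of `B16DressedActionTerm` — (w1) is NOT an
independent wall item: this file proves `BirthSlice D_τ move N 𝒦 w ϱ (B·e^{3(s+l₀B)}·l₀)` FROM the weight slice of margin `s`, the observable's
slice regularity (n14-a's hypothesis shape `hG`: along every admissible slice `G` is a.e.-measurable, holomorphic in the slice parameter, bounded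
by `B` — inhabited by Wilson words, `wilsonWord_alongSlices`), a source `‖τ‖ ≤ l₀`, and the LOAD-BEARING smallness `s + l₀·B ≤ 1`.
* `re_integral_weight_pos` ∕ `integral_weight_mem_slitPlane` [(1.74)]: the normalisation of a weight of margin `≤ 1` over a positive base
  mass has positive real part — the principal logarithm is holomorphic there.
* `differentiableOn_integral_weight_slice` [folklore]: along a slice, `t ↦ ∫ρ₀e^{σ_t}dμ` is holomorphic on the slice's open set (dominated
  holomorphic parameter integral, `Literature.Analysis.Complex.differentiableOn_integral_of_dominated`, majorant `|ρ₀|e^{s}`) — the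
  normalisation half of `T4TrajectoryDensity.opSliceOn_wOp`'s proof, isolated.
* **`birthSlice_dressLog`** — THE THEOREM: `WeightSlice ω μ move N 𝒦 w ϱ s` + `hG` + `‖τ‖ ≤ l₀` + `s + l₀B ≤ 1` ⇒
  `BirthSlice (fun U => Log ∫ω_U·e^{τG_U} − Log ∫ω_U) move N 𝒦 w ϱ (B·e^{3(s+l₀B)}·l₀)`: along every admissible slice the born term is
  `dressLog μ ρ₀ σ_t (G ∘ move U₀ d t) τ` (same `t`-independent `ρ₀`: the two logarithms share the base mass, so the (1.75)ₜ birth bound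
  `B16DressedActionTerm.norm_dressLog_le` applies pointwise in `t`), holomorphic on the intersection of the two open slice sets (two
  holomorphic normalisations in the slit plane, `DifferentiableOn.clog`), which contains the closed discs of radius `ϱ ∕ N d` about `[0,1]`.
* `birthSlice_dressLog_wilsonWord` — DECIDED INSTANCE on the lattice chart `latMove`∕`latN`: the born dressed term of a WILSON WORD
  `e^{τ·φ(∏_{b∈bs}U b)}` (n14-a's `wilsonWord_alongSlices`) along a weight slice over a bond-wise bounded window is a `BirthSlice`.
* `birthSlice_dressLog_of_exponentSliceAt` — the same from END-F's binder PAIR `RealBaseAt ref base 𝒜` + `ExponentSliceAt ref 𝒜 … s` (the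
  weight `expWeight base 𝒜`), i.e. LITERALLY from END-F's (w2-act) hypotheses: for dressed births, (w1) ⇐ (w2-act) + observable regularity.

HONEST FRAMING.  [folklore] measure theory ∕ complex calculus over hypothesis SHAPES; nothing of Bałaban's densities or observables is asserted or
instantiated (whether the genuine 𝐓′_k and loop observables inhabit `WeightSlice`∕`hG` is NODE O's); NE1′ NOT PRINTED ([Balaban1989LargeFieldII]
p. 356 ll. 1–6), NOT PROVED; this removes NO wall item for the UNDRESSED births and says nothing about (w3)⁺∕(w4)∕(I4′); N14 NOT discharged;
count-neutral.  One finite four-torus programme at fixed ε; NOT ℝ⁴, NOT OS, NOT a mass gap, NOT Clay.  0 sorry; standard axioms.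
-/

noncomputable section

namespace YMDAG.N14.DressedBirth

open MeasureTheory Set Metric Filter
open scoped Topology
open Literature.MathematicalPhysics.QuantumFieldTheory.Balaban1983to89.T4TrajectoryDensity
open Literature.MathematicalPhysics.QuantumFieldTheory.Balaban1983to89.T4BirthChartTransport (BirthSlice)
open Literature.MathematicalPhysics.QuantumFieldTheory.Balaban1983to89.B16Ineq175Tilted (tiltWeight tiltWeight_apply)
open Literature.MathematicalPhysics.QuantumFieldTheory.Balaban1983to89.B16DressedActionTerm

variable {Z : Type*} [MeasurableSpace Z] {𝒰 Dir : Type*} {μ : Measure Z}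

/-! ## §1 The normalisation of a weight: positive real part ((1.74)), holomorphy along a slice -/

/-- **(1.74) AS POSITIVITY OF THE REAL PART**: for a weight of margin `s ≤ 1` over a positive base mass, `0 < Re ∫ρ₀e^{σ}dμ`
(`mul_exp_le_re_integral_weight` BY NAME). [bookkeeping] -/
theorem re_integral_weight_pos {ρ₀ : Z → ℝ} {σ : Z → ℂ} {s : ℝ} (hρ : Integrable ρ₀ μ) (hρ0 : 0 ≤ᵐ[μ] ρ₀)
    (hP : 0 < ∫ z, ρ₀ z ∂μ) (hσm : AEStronglyMeasurable σ μ) (hσ : ∀ᵐ z ∂μ, ‖σ z‖ ≤ s) (hs : s ≤ 1) :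
    0 < (∫ z, weight ρ₀ σ z ∂μ).re :=
  lt_of_lt_of_le (mul_pos hP (Real.exp_pos _)) (mul_exp_le_re_integral_weight hρ hρ0 hσm hσ hs)

/-- Hence the normalisation lies in the slit plane, where the principal logarithm is holomorphic. [bookkeeping] -/
theorem integral_weight_mem_slitPlane {ρ₀ : Z → ℝ} {σ : Z → ℂ} {s : ℝ} (hρ : Integrable ρ₀ μ) (hρ0 : 0 ≤ᵐ[μ] ρ₀)
    (hP : 0 < ∫ z, ρ₀ z ∂μ) (hσm : AEStronglyMeasurable σ μ) (hσ : ∀ᵐ z ∂μ, ‖σ z‖ ≤ s) (hs : s ≤ 1) :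
    (∫ z, weight ρ₀ σ z ∂μ) ∈ Complex.slitPlane :=
  Complex.mem_slitPlane_iff.mpr (Or.inl (re_integral_weight_pos hρ hρ0 hP hσm hσ hs))

/-- **HOLOMORPHY OF THE NORMALISATION ALONG A SLICE** [folklore]: if `σ : ℂ → Z → ℂ` is a.e.-measurable at every `t` of an open `Ω`,
holomorphic in `t ∈ Ω` for a.e. `z` and bounded by `s` there, then `t ↦ ∫ρ₀e^{σ_t}dμ` is holomorphic on `Ω` (dominated holomorphic
parameter integral, majorant `|ρ₀|e^{s}`; the normalisation half of `T4TrajectoryDensity.opSliceOn_wOp`'s argument, isolated). -/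
theorem differentiableOn_integral_weight_slice {ρ₀ : Z → ℝ} {σ : ℂ → Z → ℂ} {Ω : Set ℂ} {s : ℝ} (hΩ : IsOpen Ω)
    (hρ : Integrable ρ₀ μ) (hσm : ∀ t ∈ Ω, AEStronglyMeasurable (σ t) μ) (hσd : ∀ᵐ z ∂μ, DifferentiableOn ℂ (fun t => σ t z) Ω)
    (hσb : ∀ᵐ z ∂μ, ∀ t ∈ Ω, ‖σ t z‖ ≤ s) :
    DifferentiableOn ℂ (fun t => ∫ z, weight ρ₀ (σ t) z ∂μ) Ω := by
  refine Literature.Analysis.Complex.differentiableOn_integral_of_dominated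
    (fun t ht => aestronglyMeasurable_weight hρ.1 (hσm t ht)) ?_ ?_
  · filter_upwards [hσd] with z hz
    exact hz.cexp.const_mul (ρ₀ z : ℂ)
  · intro t₀ ht₀
    obtain ⟨R, hR, hRΩ⟩ := Metric.isOpen_iff.mp hΩ t₀ ht₀
    refine ⟨R, hR, hRΩ, fun z => ‖ρ₀ z‖ * Real.exp s, hρ.norm.mul_const _, ?_⟩
    filter_upwards [hσb] with z hz t ht
    rw [Real.norm_eq_abs]
    exact norm_weight_le (hz t (hRΩ ht))

/-! ## §2 The born dressed term along a weight slice is a birth slice -/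

variable {ω : 𝒰 → Z → ℂ} {G : 𝒰 → Z → ℂ} {move : 𝒰 → Dir → ℂ → 𝒰} {N : Dir → ℝ} {𝒦 : Set 𝒰} {w ϱ s l₀ B : ℝ} {τ : ℂ}

/-- **THE BORN DRESSED TERM ALONG A WEIGHT SLICE IS A BIRTH SLICE** [the (w1) binder of END-F for dressed births, from (w2-act) + the
observable's slice regularity]: a weight slice of margin `s` for `ω`, an observable `G` a.e.-measurable, holomorphic and bounded by `B` along
every admissible slice (n14-a's hypothesis shape, inhabited by Wilson words), a source `‖τ‖ ≤ l₀` and the load-bearing smallness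
`s + l₀·B ≤ 1` give `BirthSlice (U ↦ Log ∫ω_U·e^{τG_U}dμ − Log ∫ω_U dμ) move N 𝒦 w ϱ (B·e^{3(s+l₀B)}·l₀)` — along the slice through
`U₀ ∈ 𝒦` in the direction `d` the born term IS `dressLog μ ρ₀ σ_t (G ∘ move U₀ d t) τ` with the slice's `t`-independent base density `ρ₀`,
so `B16DressedActionTerm.norm_dressLog_le` ((1.75)ₜ, first order in the source) bounds it pointwise in `t`, and it is holomorphic on the
intersection of the two open slice sets (two holomorphic normalisations in the slit plane, `DifferentiableOn.clog`), which contains the closed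
discs of radius `ϱ ∕ N d` about `[0,1]`. -/
theorem birthSlice_dressLog (hws : WeightSlice ω μ move N 𝒦 w ϱ s) (hτ : ‖τ‖ ≤ l₀)
    (hG : ∀ U₀ ∈ 𝒦, ∀ d : Dir, 0 < N d → N d ≤ w →
      ∃ Ω' : Set ℂ, IsOpen Ω' ∧ (∀ x ∈ Icc (0 : ℝ) 1, closedBall (x : ℂ) (ϱ / N d) ⊆ Ω') ∧
        (∀ t ∈ Ω', AEStronglyMeasurable (G (move U₀ d t)) μ) ∧
        (∀ᵐ z ∂μ, DifferentiableOn ℂ (fun t => G (move U₀ d t) z) Ω') ∧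
        (∀ᵐ z ∂μ, ∀ t ∈ Ω', ‖G (move U₀ d t) z‖ ≤ B))
    (hsmall : s + l₀ * B ≤ 1) :
    BirthSlice (fun U => Complex.log (∫ z, ω U z * Complex.exp (τ * G U z) ∂μ) - Complex.log (∫ z, ω U z ∂μ))
      move N 𝒦 w ϱ (B * Real.exp (3 * (s + l₀ * B)) * l₀) := by
  intro U₀ hU₀ d hd hdw
  obtain ⟨Ω, hΩ, hballs, ρ₀, hρ0, hρ, hP, σ, hσm, hσd, hσb, hfac⟩ := hws U₀ hU₀ d hd hdw
  obtain ⟨Ω', hΩ', hballs', hGm, hGd, hGb⟩ := hG U₀ hU₀ d hd hdw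
  -- pointwise-in-t data: bounds at a fixed t of the intersection
  have hσb' : ∀ t ∈ Ω, ∀ᵐ z ∂μ, ‖σ t z‖ ≤ s := fun t ht => hσb.mono fun z hz => hz t ht
  have hGb' : ∀ t ∈ Ω', ∀ᵐ z ∂μ, ‖G (move U₀ d t) z‖ ≤ B := fun t ht => hGb.mono fun z hz => hz t ht
  -- `0 ≤ B`, `0 ≤ s` are witnessed at any point of the slice sets (`μ ≠ 0`); the numeric consequences used below
  have hμ : μ ≠ 0 := by
    intro h0; rw [h0, integral_zero_measure] at hP; exact lt_irrefl _ hP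
  haveI : (ae μ).NeBot := ae_neBot.mpr hμ
  have hBof : ∀ t ∈ Ω', 0 ≤ B := fun t ht => by
    obtain ⟨z, hz⟩ := (hGb' t ht).exists; exact (norm_nonneg _).trans hz
  have hl₀ : 0 ≤ l₀ := (norm_nonneg τ).trans hτ
  have hτBof : ∀ t ∈ Ω', s + ‖τ‖ * B ≤ 1 := fun t ht => by
    nlinarith [mul_le_mul_of_nonneg_right hτ (hBof t ht)]
  have hs1of : ∀ t ∈ Ω', s ≤ 1 := fun t ht => by nlinarith [mul_nonneg hl₀ (hBof t ht)]
  have hsB1 : s + l₀ * B ≤ 1 := hsmall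
  -- the two normalisations along the slice, in `weight` form
  set I₁ : ℂ → ℂ := fun t => ∫ z, weight ρ₀ (fun z => σ t z + τ * G (move U₀ d t) z) z ∂μ with hI₁
  set I₀ : ℂ → ℂ := fun t => ∫ z, weight ρ₀ (σ t) z ∂μ with hI₀
  have hI₁eq : ∀ t ∈ Ω ∩ Ω', ∫ z, ω (move U₀ d t) z * Complex.exp (τ * G (move U₀ d t) z) ∂μ = I₁ t := by
    intro t ht
    refine integral_congr_ae ?_
    filter_upwards [hfac t ht.1] with z hz
    rw [hz, weight_mul_exp]
  have hI₀eq : ∀ t ∈ Ω ∩ Ω', ∫ z, ω (move U₀ d t) z ∂μ = I₀ t := fun t ht => integral_congr_ae (hfac t ht.1)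
  -- the dressed exponent's measurability, holomorphy and bound `s + l₀B` on the intersection (as in `weightSlice_dressed`)
  have hXm : ∀ t ∈ Ω ∩ Ω', AEStronglyMeasurable (fun z => σ t z + τ * G (move U₀ d t) z) μ :=
    fun t ht => (hσm t ht.1).add (aestronglyMeasurable_const.mul (hGm t ht.2))
  have hXd : ∀ᵐ z ∂μ, DifferentiableOn ℂ (fun t => σ t z + τ * G (move U₀ d t) z) (Ω ∩ Ω') := by
    filter_upwards [hσd, hGd] with z hz hz'
    exact (hz.mono inter_subset_left).add ((hz'.mono inter_subset_right).const_mul τ)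
  have hXb : ∀ᵐ z ∂μ, ∀ t ∈ Ω ∩ Ω', ‖σ t z + τ * G (move U₀ d t) z‖ ≤ s + l₀ * B := by
    filter_upwards [hσb, hGb] with z hz hz' t ht
    calc ‖σ t z + τ * G (move U₀ d t) z‖ ≤ ‖σ t z‖ + ‖τ * G (move U₀ d t) z‖ := norm_add_le _ _
      _ ≤ s + l₀ * B := by
          rw [norm_mul]
          exact add_le_add (hz t ht.1) (mul_le_mul hτ (hz' t ht.2) (norm_nonneg _) hl₀)
  -- holomorphy of both normalisations on the intersection, and membership in the slit plane
  have hI₁d : DifferentiableOn ℂ I₁ (Ω ∩ Ω') :=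
    differentiableOn_integral_weight_slice (σ := fun t z => σ t z + τ * G (move U₀ d t) z) (hΩ.inter hΩ') hρ hXm hXd hXb
  have hI₀d : DifferentiableOn ℂ I₀ (Ω ∩ Ω') :=
    (differentiableOn_integral_weight_slice hΩ hρ hσm hσd hσb).mono inter_subset_left
  have hI₁s : ∀ t ∈ Ω ∩ Ω', I₁ t ∈ Complex.slitPlane := fun t ht =>
    integral_weight_mem_slitPlane hρ hρ0 hP (hXm t ht) (hXb.mono fun z hz => hz t ht) hsB1
  have hI₀s : ∀ t ∈ Ω ∩ Ω', I₀ t ∈ Complex.slitPlane := fun t ht =>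
    integral_weight_mem_slitPlane hρ hρ0 hP (hσm t ht.1) (hσb' t ht.1) (hs1of t ht.2)
  refine ⟨Ω ∩ Ω', ?_, ?_, fun x hx => subset_inter (hballs x hx) (hballs' x hx)⟩
  · -- holomorphy of the born term along the slice
    have hD : DifferentiableOn ℂ (fun t => Complex.log (I₁ t) - Complex.log (I₀ t)) (Ω ∩ Ω') :=
      (hI₁d.clog hI₁s).sub (hI₀d.clog hI₀s)
    refine hD.congr fun t ht => ?_
    show Complex.log _ - Complex.log _ = Complex.log (I₁ t) - Complex.log (I₀ t)
    rw [hI₁eq t ht, hI₀eq t ht]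
  · -- the (1.75)ₜ birth bound, pointwise in t: the born term is `dressLog μ ρ₀ σ_t (G ∘ move U₀ d t) τ`
    intro t ht
    have hD : Complex.log (∫ z, ω (move U₀ d t) z * Complex.exp (τ * G (move U₀ d t) z) ∂μ) -
        Complex.log (∫ z, ω (move U₀ d t) z ∂μ) = dressLog μ ρ₀ (σ t) (G (move U₀ d t)) τ := by
      rw [hI₁eq t ht, hI₀eq t ht, dressLog, tiltNorm_def, tiltNorm_def]
      congr 2
      refine integral_congr_ae (Eventually.of_forall fun z => ?_)
      simp only [tiltWeight_apply, weight_apply, zero_mul, add_zero]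
    show ‖Complex.log _ - Complex.log _‖ ≤ _
    rw [hD]
    have hB : 0 ≤ B := hBof t ht.2
    refine (norm_dressLog_le hρ hρ0 hP (hσm t ht.1) (hGm t ht.2) (hσb' t ht.1) (hGb' t ht.2) (hτBof t ht.2)).trans ?_
    have hexp : Real.exp (3 * (s + ‖τ‖ * B)) ≤ Real.exp (3 * (s + l₀ * B)) :=
      Real.exp_le_exp.mpr (by nlinarith [mul_le_mul_of_nonneg_right hτ hB])
    exact mul_le_mul (mul_le_mul_of_nonneg_left hexp hB) hτ (norm_nonneg _) (mul_nonneg hB (Real.exp_pos _).le)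

/-- **THE SAME FROM END-F's (w2-act) BINDER PAIR** [folklore]: `RealBaseAt ref base 𝒜 μ 𝒦` + `ExponentSliceAt ref 𝒜 μ move N 𝒦 w ϱ s` (the
printed TYPE [Balaban1989LargeFieldII] (1.65) p. 375 ∕ (1.71)–(1.75) pp. 379–380 of the ACTION exponent — END-F's `hB`∕`hE`) + the observable's
slice regularity + `‖τ‖ ≤ l₀` + `s + l₀·B ≤ 1` ⇒ the born dressed term of the exponent-form family `expWeight base 𝒜` is a `BirthSlice` with the
(1.75)ₜ birth size: for DRESSED births, (w1) ⇐ (w2-act) + observable regularity. -/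
theorem birthSlice_dressLog_of_exponentSliceAt {ref : 𝒰 → 𝒰} {base : Z → ℝ} {𝒜 : 𝒰 → Z → ℂ}
    (hB : RealBaseAt ref base 𝒜 μ 𝒦) (hE : ExponentSliceAt ref 𝒜 μ move N 𝒦 w ϱ s) (hτ : ‖τ‖ ≤ l₀)
    (hG : ∀ U₀ ∈ 𝒦, ∀ d : Dir, 0 < N d → N d ≤ w →
      ∃ Ω' : Set ℂ, IsOpen Ω' ∧ (∀ x ∈ Icc (0 : ℝ) 1, closedBall (x : ℂ) (ϱ / N d) ⊆ Ω') ∧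
        (∀ t ∈ Ω', AEStronglyMeasurable (G (move U₀ d t)) μ) ∧
        (∀ᵐ z ∂μ, DifferentiableOn ℂ (fun t => G (move U₀ d t) z) Ω') ∧
        (∀ᵐ z ∂μ, ∀ t ∈ Ω', ‖G (move U₀ d t) z‖ ≤ B))
    (hsmall : s + l₀ * B ≤ 1) :
    BirthSlice (fun U => Complex.log (∫ z, expWeight base 𝒜 U z * Complex.exp (τ * G U z) ∂μ) -
        Complex.log (∫ z, expWeight base 𝒜 U z ∂μ)) move N 𝒦 w ϱ (B * Real.exp (3 * (s + l₀ * B)) * l₀) :=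
  birthSlice_dressLog (weightSlice_of_exponentSliceAt hB hE) hτ hG hsmall

/-! ## §3 Decided instance on the lattice chart: the born dressed term of a Wilson word -/

section WilsonWord

open Literature.MathematicalPhysics.QuantumFieldTheory.Balaban1983to89.T4BlockTransport (Site Fld NDir latN latMove)

/-- **THE BORN DRESSED TERM OF A WILSON WORD ALONG THE LATTICE CHART IS A BIRTH SLICE** [decided instance]: a weight slice of margin `s` on
the affine lattice chart `latMove`∕`latN` of `T4BlockTransport` over a bond-wise bounded window (`‖U b‖ ≤ u`, `0 ≤ ϱ`), dressed by the Wilson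
word `e^{τ·φ(∏_{b∈bs} U b)}` (`φ : R →L[ℂ] ℂ`, e.g. a normalised trace) with `‖τ‖ ≤ l₀` under the smallness `s + l₀·B ≤ 1`,
`B = ‖φ‖·‖1‖·(u + 2w + ϱ)^{|bs|}`: the born dressed term `U ↦ Log ∫ω_U e^{τφ(∏U b)} − Log ∫ω_U` is a `BirthSlice` with the (1.75)ₜ size
`B·e^{3(s+l₀B)}·l₀` — `birthSlice_dressLog` on n14-a's `wilsonWord_alongSlices`.  (The kind of observable the programme attaches; nothing of
Bałaban's weights asserted — the weight slice is the hypothesis.) -/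
theorem birthSlice_dressLog_wilsonWord {R : Type*} [NormedRing R] [NormedAlgebra ℂ R] {d : ℕ} {ω : Fld d R → Z → ℂ}
    {𝒦 : Set (Fld d R)} {w ϱ s u l₀ : ℝ} {τ : ℂ} (hws : WeightSlice ω μ latMove latN 𝒦 w ϱ s) (hτ : ‖τ‖ ≤ l₀)
    (hu0 : 0 ≤ u) (hu : ∀ U ∈ 𝒦, ∀ x ν, ‖U x ν‖ ≤ u) (hϱ : 0 ≤ ϱ) (bs : List (Site d × Fin d)) (φ : R →L[ℂ] ℂ)
    (hsmall : s + l₀ * (‖φ‖ * ‖(1 : R)‖ * (u + 2 * w + ϱ) ^ bs.length) ≤ 1) :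
    BirthSlice (fun U => Complex.log (∫ z, ω U z * Complex.exp (τ * φ (bs.map fun b => U b.1 b.2).prod) ∂μ) -
        Complex.log (∫ z, ω U z ∂μ)) latMove latN 𝒦 w ϱ
      ((‖φ‖ * ‖(1 : R)‖ * (u + 2 * w + ϱ) ^ bs.length) *
        Real.exp (3 * (s + l₀ * (‖φ‖ * ‖(1 : R)‖ * (u + 2 * w + ϱ) ^ bs.length))) * l₀) :=
  birthSlice_dressLog (G := fun (U : Fld d R) (_ : Z) => φ (bs.map fun b => U b.1 b.2).prod)
    (B := ‖φ‖ * ‖(1 : R)‖ * (u + 2 * w + ϱ) ^ bs.length) hws hτ (fun U₀ hU₀ p hp hpw => by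
      obtain ⟨Ω', h1, h2, h3, h4, h5⟩ := wilsonWord_alongSlices bs φ μ hu0 hu hϱ U₀ hU₀ p hp hpw
      exact ⟨Ω', h1, h2, h3, h4, h5⟩) hsmall

end WilsonWord

end YMDAG.N14.DressedBirth

end
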